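import Summits.BirchSwinnertonDyer.BirchSwinnertonDyer.Theorems.GoldfeldAllTwistsTwoConverseTwinAdditiveTwoInertThreeTwistSelmer
import HarnessLib

set_option linter.dupNamespace false -- namespace `…BirchSwinnertonDyer.BirchSwinnertonDyer…` is the cell's (D-0017 nested layout)
set_option autoImplicit false

/-!
# Twin″ (item 19140), XI: `rank ≤ 1`, `Ш[2] = 0` in rank one, and `BSD(W,2)` as a `2`-adic unit
# statement for `49a1^{(−2ℓ)}`, `ℓ ≡ 3 (mod 8)` prime INERT in `ℚ(√−7)`

Cell `bsd-goldfeld`, seat `bsd-goldfeld-s1p-c301` (gen 2); `--supports stmt-BirchSwinnertonDyer-19140`. From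
part X (`#S(−42ℓ,448ℓ²) ≤ 2`, `#S(84ℓ,−28ℓ²) ≤ 4`) and part VII's counting / transport lemmas: for every
model `W/ℚ` of `49a1^{(−2ℓ)}` (`C • W = cm7.quadraticTwist (−2ℓ)`), `ℓ ≡ 3 (mod 8)` prime, `(−7/ℓ) = −1`:

* `rank W(ℚ) ≤ 1` UNCONDITIONALLY and `rank W(ℚ) = 1 ⇒ Ш(W/ℚ)[2] = 0`
  (`rank_le_one_and_sha_two_twoInertThreeTwist`);
* in analytic rank one, granted GZK: `rank = 1`, `Ш(W)[2^∞] = 0`, `corank_{ℤ₂} Sel_{2^∞}(W) = 1` and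
  **`BSD(W,2) ⟺ ∃ q : ℚ, #Ш_an(W) = q ∧ ord₂ q = 0`** (`bsdp_two_iff_shaAn_unit_twoInertThreeTwist`).

Coverage of the additive prime twists after parts I–XI: `49a1^{(−ℓ)}` for all primes `ℓ ≡ 5 (mod 8)` and
all inert `ℓ ≡ 1 (mod 8)`; `49a1^{(−2ℓ)}` for all inert `ℓ ≢ 7 (mod 8)`. HONEST FRAMING: no `BSD(W,2)` is
proved; BSD is not proved by any of this.

References: Silverman, *AEC* (2009), X.4.2(a), X.4.9 [SilvermanAEC2009]; Miller, LMS JCM 14 (2011), Def. 1.1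
[Miller2011LMS].
-/

noncomputable section

open scoped Classical

open WeierstrassCurve Literature.NumberTheory.EllipticCurves

namespace Summit.BirchSwinnertonDyer.BirchSwinnertonDyer.Theorems.GoldfeldGoodTwists

/-- **`rank E_{−2ℓ}(ℚ) ≤ 1`, and `rank = 1 ⇒ Ш(E_{−2ℓ}/ℚ)[2] = 0`** (UNCONDITIONAL) for the two-torsion model
`E_{−2ℓ} : y² = x³ − 42ℓx² + 448ℓ²x`, `ℓ ≡ 3 (mod 8)` prime with `(−7/ℓ) = −1` (`#S · #S' ≤ 8`).
[cite: SilvermanAEC2009, Thm. X.4.2(a), Prop. X.4.9] -/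
theorem rank_le_one_and_sha_two_twoTorsionModel_twoInertThreeTwist {l : ℕ} [Fact l.Prime]
    (hl8 : l % 8 = 3) (hl7 : legendreSym l (-7) = -1)
    [hE : (⟨0, ((-42 * l : ℤ) : ℚ), 0, ((448 * l ^ 2 : ℤ) : ℚ), 0⟩ : WeierstrassCurve ℚ).IsElliptic] :
    (⟨0, ((-42 * l : ℤ) : ℚ), 0, ((448 * l ^ 2 : ℤ) : ℚ), 0⟩ : WeierstrassCurve ℚ).mordellWeilRank ≤ 1 ∧
      ((⟨0, ((-42 * l : ℤ) : ℚ), 0, ((448 * l ^ 2 : ℤ) : ℚ), 0⟩ : WeierstrassCurve ℚ).mordellWeilRank = 1 →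
        ∀ c ∈ (⟨0, ((-42 * l : ℤ) : ℚ), 0, ((448 * l ^ 2 : ℤ) : ℚ), 0⟩ : WeierstrassCurve ℚ).sha,
          2 • c = 0 → c = 0) := by
  have hl : l.Prime := Fact.out
  have hab := hab_inertTwoTwist hl.pos
  haveI := isElliptic_halfModel hab
  have hS := card_twoIsogenySelmerGroup_twoInertThreeTwist_le hl8 hl7
  have hS' := card_twoIsogenySelmerGroup'_twoInertThreeTwist_le hl8 hl7
  obtain ⟨hr, hparts⟩ := rank_le_one_and_sha_parts_of_card_mul_le hab
    (by nlinarith [hS, hS', Nat.zero_le (twoIsogenySelmerGroup (-42 * l) (448 * l ^ 2)).card])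
  refine ⟨hr, fun h => ?_⟩
  obtain ⟨h₀, h₁⟩ := hparts h
  exact forall_mem_sha_two_smul_eq_zero_of_halfModel h₀ h₁

/-- **UNCONDITIONAL: `rank W(ℚ) ≤ 1`, and `rank W(ℚ) = 1 ⇒ Ш(W/ℚ)[2] = 0`, for every model `W` of
`49a1^{(−2ℓ)}`**, `ℓ ≡ 3 (mod 8)` prime with `(−7/ℓ) = −1`.
[cite: SilvermanAEC2009, Thm. X.4.2(a), Prop. X.4.9, Thm. III.6.2(a)] -/
theorem rank_le_one_and_sha_two_twoInertThreeTwist {l : ℕ} [Fact l.Prime] (hl8 : l % 8 = 3)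
    (hl7 : legendreSym l (-7) = -1) (W : WeierstrassCurve ℚ) [W.IsElliptic] (C : VariableChange ℚ)
    (hC : C • W = cm7.quadraticTwist ((-2 * l : ℤ) : ℚ)) :
    W.mordellWeilRank ≤ 1 ∧ (W.mordellWeilRank = 1 → ∀ c ∈ W.sha, 2 • c = 0 → c = 0) := by
  have hl : l.Prime := Fact.out
  haveI := isElliptic_mk_of_ne_zero (F := ℚ) (hab_inertTwoTwist hl.pos)
  have hE := (smul_eq_twoTorsionModel_of_smul_eq_quadraticTwist (-2 * l) W C hC).trans
    (show (⟨0, ((21 * (-2 * l : ℤ) : ℤ) : ℚ), 0, ((112 * (-2 * l : ℤ) ^ 2 : ℤ) : ℚ), 0⟩ :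
        WeierstrassCurve ℚ) = ⟨0, ((-42 * l : ℤ) : ℚ), 0, ((448 * l ^ 2 : ℤ) : ℚ), 0⟩ by
      ext <;> push_cast <;> ring)
  exact rank_le_one_and_sha_two_of_smul_eq W _ _ hE
    (rank_le_one_and_sha_two_twoTorsionModel_twoInertThreeTwist hl8 hl7)

/-- **Twin″ on `49a1^{(−2ℓ)}`, `ℓ ≡ 3 (mod 8)` prime inert in `ℚ(√−7)`**: for every model `W` of analytic
rank `1`, granted GZK: `rank = 1`, `Ш(W)[2^∞] = 0`, `corank_{ℤ₂} Sel_{2^∞}(W) = 1`, and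
`BSD(W,2) ⟺ ∃ q : ℚ, #Ш_an(W) = q ∧ ord₂ q = 0`. [cite: SilvermanAEC2009, Thm. X.4.2(a), Prop. X.4.9]
[cite: Miller2011LMS, Def. 1.1] [cite: Greenberg1999LNM, §1 pp. 54–57] -/
theorem bsdp_two_iff_shaAn_unit_twoInertThreeTwist (hGZK : rank_eq_analyticRank_of_analyticRank_le_one)
    {l : ℕ} [Fact l.Prime] (hl8 : l % 8 = 3) (hl7 : legendreSym l (-7) = -1)
    (W : WeierstrassCurve ℚ) [W.IsElliptic] (C : VariableChange ℚ)
    (hC : C • W = cm7.quadraticTwist ((-2 * l : ℤ) : ℚ)) (har : W.analyticRank = 1) :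
    W.mordellWeilRank = 1 ∧ AddCommGroup.primaryComponent W.sha 2 = ⊥ ∧ W.selmerCorank 2 = 1 ∧
      (BSDp W 2 ↔ ∃ q : ℚ, shaAn W = (q : ℂ) ∧ padicValRat 2 q = 0) := by
  haveI : Fact (Nat.Prime 2) := ⟨Nat.prime_two⟩
  have hrank : W.mordellWeilRank = W.analyticRank := (hGZK W (by rw [har])).1
  have hr : W.mordellWeilRank = 1 := by rw [hrank, har]
  have h2 := (rank_le_one_and_sha_two_twoInertThreeTwist hl8 hl7 W C hC).2 hr
  obtain ⟨hbot, hiff⟩ := bsdp_two_iff_shaAn_unit_of_forall_mem_sha W h2 hrank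
  refine ⟨hr, hbot, ?_, hiff⟩
  rw [W.selmerCorank_eq_mordellWeilRank_add_holds 2, hr, W.shaCorank_eq_zero_of_forall 2 h2]

end Summit.BirchSwinnertonDyer.BirchSwinnertonDyer.Theorems.GoldfeldGoodTwists

end
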